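import Literature.Geometry.Lorentzian.TracedGaussEquation
import Literature.Geometry.Lorentzian.GerochMonotonicityIntegrability
import Literature.Geometry.Lorentzian.CurvatureRegularity
import Literature.Geometry.Lorentzian.DalembertianCompose
import Literature.Geometry.Lorentzian.ConnectionNaturality
import Literature.Geometry.Lorentzian.ChartLaplacian
import Literature.Geometry.Lorentzian.EnergyCurrents
import Literature.Geometry.Lorentzian.VolumeProofs
import Literature.Geometry.Lorentzian.SchoenYauLogCutoff
import HarnessLib

/-!
# Schoen–Yau 1979, §2, Step 3 on an immersed stable minimal surface: (2.13) ⟹ (2.16)–(2.18)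

Schoen–Yau, *On the proof of the positive mass conjecture in general relativity*, Comm. Math.
Phys. 65 (1979), §2, Step 3, pp. 53–55: for the complete area-minimising surface `S` of Step 2
in the asymptotically flat `(N³, ds²)` with `R ≥ 0`, the second variation inequality (2.13),
`∫_S (Ric(ν,ν) + ‖A‖²) f² ≤ ∫_S ‖∇f‖²` for compactly supported `f`, together with the Gauss
equation (2.14), minimality (2.12), quadratic area growth (2.9) and the decay of the ambient
curvature gives `∫_S ‖A‖² < ∞` (2.16), `∫_S |K| < ∞` (2.17) and `0 < ½ ∫_S (R + ‖A‖²) ≤ ∫_S K`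
(2.18). `SchoenYauLogCutoff.lean` proved the measure-theoretic core of this passage (the
logarithmic cut-off argument). This file proves the passage itself **on an immersed surface**,
in the tree's hypersurface vocabulary (`Hypersurface.lean`: spacelike immersion `f : N² → M³`,
induced metric `f^*g`, unit normal `ν`, second fundamental form `K_ν`, `IsMaximalSlice` =
vanishing mean curvature; `Volume.lean`: the area measure `riemannianMeasure (f^*g)`;
`EnergyCurrents.lean`: `gradSq`, the gradient square `‖∇u‖²`):

* `SchoenYau.curvature_integrals_of_stable_minimal` — **(2.13) ⟹ (2.16)–(2.18)**: for a smooth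
  minimal immersion of a surface into a Riemannian `3`-manifold with `R ≥ 0` along it, a
  smooth proper-along-`f` exhaustion `ρ ≥ 1` of `M` with `‖∇ρ‖² ≤ C₃`, quadratic area growth
  `Area{ρ∘f ≤ t} ≤ C t²`, the decay `|R/2 − Ric(ν,ν)| ≤ Λ' ρ⁻³` of the sectional curvature
  `K₁₂` of the tangent planes, and the stability inequality (2.13) for all smooth compactly
  supported test functions: `‖A‖², K, R∘f ∈ L¹(Area)`, `½ ∫ (R + ‖A‖²) ≤ ∫ K`, strict
  positivity of the left side as soon as `{R∘f > 0}` has positive area.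

Pointwise lemmas (all proved): `PseudoRiemannianMetric.val_sq_le_mul` (Cauchy–Schwarz for a
Riemannian metric), `IsRiemannian.gradSq_nonneg`, `gradSq_real_comp_eq_deriv_sq_mul`
(`‖∇(η∘u)‖² = η'(u)² ‖∇u‖²`),
`gradSq_comp_le_of_isSpacelikeImmersion` (`‖∇_{f^*g}(ρ∘f)‖² ≤ ‖∇_g ρ‖² ∘ f`).

Everything is proved; no definitions, no named facts. For the hypothesis `h₂₃` (Steps 2–3) of
`schoenYau_mass_nonneg_of_steps23` it remains to produce the surface (Step 2: the Plateau
solutions and their limit, pp. 49–52 — geometric measure theory), its area growth (2.9) and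
stability (2.13) from the minimising property (second variation of area), the extended radius
`r'` with the decay of `K₁₂` from (1.1), and then Remark 2.1 with the Claim `∫_S K ≤ 0`
(Cohn-Vossen, Huber/Finn or Gauss–Bonnet with boundary, pp. 55–63).

## References

* R. Schoen, S.-T. Yau, *On the proof of the positive mass conjecture in general relativity*,
  Comm. Math. Phys. 65 (1979) 45–76: §2, Step 3, (2.9)–(2.18), pp. 52–55. [SchoenYauPMT1979]
* B. O'Neill, *Semi-Riemannian geometry*, Academic Press 1983, Ch. 4 (Gauss equation).
-/

noncomputable section

open Bundle Set Filter Function Manifold MeasureTheory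
open scoped Manifold ContDiff Topology

namespace Literature.Geometry.Lorentzian

namespace PseudoRiemannianMetric

/-! ### Pointwise: Cauchy–Schwarz, gradient of a composite, gradient of a restriction -/

section Pointwise

variable {E : Type*} [NormedAddCommGroup E] [NormedSpace ℝ E] {H : Type*} [TopologicalSpace H]
  {I : ModelWithCorners ℝ E H} {M : Type*} [TopologicalSpace M] [ChartedSpace H M]
  [IsManifold I ∞ M] {n : ℕ∞ω} [FiniteDimensional ℝ E]
  (g : PseudoRiemannianMetric I n E (TangentSpace I : M → Type _))

omit [FiniteDimensional ℝ E] in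
/-- **Cauchy–Schwarz** for a Riemannian metric: `g(v, w)² ≤ g(v, v) g(w, w)`. [folklore] -/
theorem val_sq_le_mul (hg : g.IsRiemannian) (x : M) (v w : TangentSpace I x) :
    g.val x v w ^ 2 ≤ g.val x v v * g.val x w w := by
  by_cases hw : w = 0
  · subst hw
    simp
  have hc : 0 < g.val x w w := hg x w hw
  set t : ℝ := g.val x v w / g.val x w w with ht
  have hnn : 0 ≤ g.val x (v - t • w) (v - t • w) := by
    by_cases h0 : v - t • w = 0
    · rw [h0]; simp
    · exact (hg x _ h0).le
  have hexp : g.val x (v - t • w) (v - t • w) =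
      g.val x v v - 2 * t * g.val x v w + t ^ 2 * g.val x w w := by
    simp only [map_sub, map_smul, _root_.sub_apply, FunLike.coe_smul,
      Pi.smul_apply, smul_eq_mul, g.symm x w v]
    ring
  rw [hexp, ht] at hnn
  have key : g.val x v w ^ 2 / g.val x w w ≤ g.val x v v := by
    have : g.val x v v - 2 * (g.val x v w / g.val x w w) * g.val x v w +
        (g.val x v w / g.val x w w) ^ 2 * g.val x w w =
          g.val x v v - g.val x v w ^ 2 / g.val x w w := by
      field_simp
      ring
    linarith [this ▸ hnn]
  rwa [div_le_iff₀ hc] at key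

omit [FiniteDimensional ℝ E] in
/-- `g(v, v) ≥ 0` for a Riemannian metric. [folklore] -/
theorem val_self_nonneg (hg : g.IsRiemannian) (x : M) (v : TangentSpace I x) :
    0 ≤ g.val x v v := by
  by_cases hv : v = 0
  · rw [hv]; simp
  · exact (hg x v hv).le

variable {g} in
/-- `|∇ψ|²_g ≥ 0` for a Riemannian metric. [folklore] -/
theorem IsRiemannian.gradSq_nonneg (hg : g.IsRiemannian) (ψ : M → ℝ) (x : M) :
    0 ≤ g.gradSq ψ x := by
  rw [gradSq, innerDual_eq_val_sharp_sharp]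
  exact g.val_self_nonneg hg x _

/-- **Gradient of a composite with a real function**: `|∇(η ∘ u)|² = η'(u)² |∇u|²`
(`d(η ∘ u) = η'(u) du`). [folklore] -/
theorem gradSq_real_comp_eq_deriv_sq_mul {u : M → ℝ} {η : ℝ → ℝ} {x : M}
    (hη : DifferentiableAt ℝ η (u x)) (hu : MDifferentiableAt I 𝓘(ℝ, ℝ) u x) :
    g.gradSq (η ∘ u) x = deriv η (u x) ^ 2 * g.gradSq u x := by
  have hd : mvfderiv I (η ∘ u) x = deriv η (u x) • mvfderiv I u x := by
    ext v
    rw [mvfderiv_real_comp hη hu v, _root_.smul_apply, smul_eq_mul]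
  simp only [gradSq_eq, hd, ContinuousLinearMap.toLinearMap_smul, map_smul, _root_.smul_apply,
    smul_eq_mul]
  ring

variable {E' : Type*} [NormedAddCommGroup E'] [NormedSpace ℝ E'] {H' : Type*} [TopologicalSpace H']
  {I' : ModelWithCorners ℝ E' H'} {N : Type*} [TopologicalSpace N] [ChartedSpace H' N]
  [FiniteDimensional ℝ E'] [IsManifold I' ∞ N]

/-- **The surface gradient is dominated by the ambient gradient.** For a spacelike immersion
`f : (N, f^*g) → (M, g)` into a Riemannian manifold and `ρ : M → ℝ`:
`|∇_{f^*g}(ρ ∘ f)|²(y) ≤ |∇_g ρ|²(f y)` (`d(ρ ∘ f)_y = dρ_{f y} ∘ df_y` and `df_y` is an isometry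
onto its image; Cauchy–Schwarz). This is the bound `‖∇r‖² ≤ C₃` on `S` from `(1.1)` in
Schoen–Yau 1979, p. 54. [folklore] -/
theorem gradSq_comp_le_of_isSpacelikeImmersion (hg : g.IsRiemannian) {f : N → M}
    (hpb : contMDiff_pullbackBilin I M I' N n) (hfi : g.IsSpacelikeImmersion I' f)
    {ρ : M → ℝ} {y : N} (hρ : MDifferentiableAt I 𝓘(ℝ, ℝ) ρ (f y))
    (hf : MDifferentiableAt I' I f y) :
    (g.inducedMetric f hpb hfi).gradSq (ρ ∘ f) y ≤ g.gradSq ρ (f y) := by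
  set gN := g.inducedMetric f hpb hfi with hgN
  set α : Module.Dual ℝ (TangentSpace I (f y)) :=
    (mvfderiv I ρ (f y) : TangentSpace I (f y) →ₗ[ℝ] ℝ)
  set β : Module.Dual ℝ (TangentSpace I' y) :=
    (mvfderiv I' (ρ ∘ f) y : TangentSpace I' y →ₗ[ℝ] ℝ)
  have hβ : ∀ v, β v = α (mfderiv I' I f y v) := fun v ↦ mvfderiv_comp_apply hρ hf v
  set w := gN.sharp y β with hw
  set uu := g.sharp (f y) α with huu
  -- the two gradient squares
  have hGN : gN.gradSq (ρ ∘ f) y = g.val (f y) uu (mfderiv I' I f y w) := by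
    rw [gradSq_eq, huu, val_sharp_apply]
    exact hβ _
  have hGM : g.gradSq ρ (f y) = g.val (f y) uu uu := by
    rw [gradSq, innerDual_eq_val_sharp_sharp]
  have hww : g.val (f y) (mfderiv I' I f y w) (mfderiv I' I f y w) = gN.gradSq (ρ ∘ f) y := by
    rw [gradSq, innerDual_eq_val_sharp_sharp]
    rfl
  -- Cauchy–Schwarz: `G_N² ≤ G_M G_N`
  have hCS := g.val_sq_le_mul hg (f y) uu (mfderiv I' I f y w)
  rw [← hGN, ← hGM, hww] at hCS
  have hGM0 : 0 ≤ g.gradSq ρ (f y) := hg.gradSq_nonneg ρ (f y)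
  by_cases hpos : 0 < gN.gradSq (ρ ∘ f) y
  · exact le_of_mul_le_mul_right (by nlinarith [hCS]) hpos
  · exact (not_lt.1 hpos).trans hGM0

end Pointwise

end PseudoRiemannianMetric

/-! ### Step 3 on a stable minimal immersed surface -/

namespace SchoenYau

open PseudoRiemannianMetric

variable {E : Type*} [NormedAddCommGroup E] [NormedSpace ℝ E] {H : Type*} [TopologicalSpace H]
  {I : ModelWithCorners ℝ E H} {M : Type*} [TopologicalSpace M] [ChartedSpace H M]
  [IsManifold I ∞ M] [FiniteDimensional ℝ E] [CompleteSpace E]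
  (g : PseudoRiemannianMetric I ∞ E (TangentSpace I : M → Type _)) [g.HasLeviCivita]
  {E' : Type*} [NormedAddCommGroup E'] [NormedSpace ℝ E'] {H' : Type*} [TopologicalSpace H']
  {I' : ModelWithCorners ℝ E' H'} {N : Type*} [TopologicalSpace N] [ChartedSpace H' N]
  [IsManifold I' ∞ N] [FiniteDimensional ℝ E'] [CompleteSpace E'] [I'.Boundaryless]
  [T3Space N] [MeasurableSpace N] [BorelSpace N]

/-- **Schoen–Yau 1979, §2, Step 3, (2.13) ⟹ (2.16)–(2.18), for a stable minimal immersed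
surface.** Let `(M³, g)` be a Riemannian `3`-manifold and `f : N² → M` a smooth spacelike
(= Riemannian) immersion with induced metric `f^*g`, a unit normal field `ν` with smooth lift,
and vanishing mean curvature ((2.12), `IsMaximalSlice`). Let `ρ ≥ 1` be a smooth function on `M`
with bounded gradient, `|∇ρ|²_g ≤ C₃` (Schoen–Yau's extended coordinate radius `r'`, p. 52, with
`‖∇r‖² ≤ C₃` from (1.1), p. 54), *proper along `f`* (the sets `{ρ ∘ f ≤ t}` are compact: `S` is
properly immersed with `S ∩ (N ∖ N_k)` compact), and assume: **(2.9)** quadratic area growth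
`Area{ρ ∘ f ≤ t} ≤ C t²` (`t ≥ 1`) for the area measure `μ` of `f^*g`; **`R ≥ 0`** along `f`;
the decay **`K₁₂ = R/2 − Ric(ν, ν) = O(ρ⁻³)`** of the ambient sectional curvature of the tangent
planes (from (1.1), p. 55); and the **stability inequality (2.13)**,
`∫ (Ric(ν,ν) + ‖A‖²) u² dμ ≤ ∫ ‖∇u‖² dμ` for all smooth compactly supported `u` on `N`. Then,
with `‖A‖² = |K_ν|²_{f^*g}` and the Gauss curvature `K = S_{f^*g}/2`: `‖A‖² ∈ L¹` ((2.16)),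
`K ∈ L¹` ((2.17)), `R ∘ f ∈ L¹`, `½ ∫ (R + ‖A‖²) ≤ ∫ K`, and `0 < ½ ∫ (R + ‖A‖²)` whenever
`{R ∘ f > 0}` has positive area ((2.18)). Proof: the traced Gauss equation (2.14)
(`scalarCurvature_inducedMetric_eq`) with `H = 0` turns the integrand of (2.13) into that of
(2.15), `Ric(ν,ν) + ‖A‖² = R/2 − K + ‖A‖²/2`, and gives `K + ‖A‖²/2 = K₁₂`; radial test functions
`u = η(ρ ∘ f)` have `‖∇u‖² = η'(ρ∘f)² ‖∇(ρ∘f)‖² ≤ C₃ η'(ρ∘f)²`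
(`gradSq_real_comp_eq_deriv_sq_mul`, `gradSq_comp_le_of_isSpacelikeImmersion`); the rest is
the logarithmic cut-off argument of pp. 54–55 (`integral_gauss_curvature_pos_of_stability'`,
`SchoenYauLogCutoff.lean`). [cite: SchoenYauPMT1979, §2, Step 3, pp. 53–55, (2.13)–(2.18)] -/
theorem curvature_integrals_of_stable_minimal (hg : g.IsRiemannian)
    (h3 : Module.finrank ℝ E = 3) (h2 : Module.finrank ℝ E' = 2)
    {f : N → M} (hpb : contMDiff_pullbackBilin I M I' N ∞) (hfi : g.IsSpacelikeImmersion I' f)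
    {ν : NormalField I f}
    (hν : ContMDiff I' I.tangent ∞ (fun x ↦ (TotalSpace.mk' E (f x) (ν x) : TangentBundle I M)))
    (hun : g.IsUnitNormal I' f ν 1) (hmin : g.IsMaximalSlice f hpb hfi ν)
    {ρ : M → ℝ} (hρs : CMDiff ∞ ρ) (hρ1 : ∀ x, 1 ≤ ρ x) {C₃ : ℝ} (hC₃ : ∀ x, g.gradSq ρ x ≤ C₃)
    (hproper : ∀ t : ℝ, IsCompact {y : N | ρ (f y) ≤ t})
    {C : ℝ} (hC : 0 ≤ C)
    (hG : ∀ t : ℝ, 1 ≤ t → riemannianMeasure (g.inducedRiemannianMetric f hpb hfi)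
      {y | ρ (f y) ≤ t} ≤ ENNReal.ofReal (C * t ^ 2))
    (hR0 : ∀ y : N, 0 ≤ g.scalarCurvature (f y)) {Λ' : ℝ}
    (hK12 : ∀ y : N, |g.scalarCurvature (f y) / 2 - g.ricci (f y) (ν y) (ν y)| ≤
      Λ' * (ρ (f y))⁻¹ ^ 3)
    (hstab : ∀ u : N → ℝ, CMDiff ∞ u → HasCompactSupport u →
      ∫ y, (g.ricci (f y) (ν y) (ν y) +
          (g.inducedMetric f hpb hfi).normSq y (g.secondFundamentalForm I' f ν y)) * u y ^ 2
        ∂(riemannianMeasure (g.inducedRiemannianMetric f hpb hfi)) ≤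
      ∫ y, (g.inducedMetric f hpb hfi).gradSq u y
        ∂(riemannianMeasure (g.inducedRiemannianMetric f hpb hfi))) :
    haveI := (g.inducedMetric f hpb hfi).hasLeviCivita
    Integrable (fun y ↦ g.scalarCurvature (f y))
        (riemannianMeasure (g.inducedRiemannianMetric f hpb hfi)) ∧
      Integrable (fun y ↦ (g.inducedMetric f hpb hfi).normSq y (g.secondFundamentalForm I' f ν y))
        (riemannianMeasure (g.inducedRiemannianMetric f hpb hfi)) ∧
      Integrable (fun y ↦ (g.inducedMetric f hpb hfi).scalarCurvature y / 2)
        (riemannianMeasure (g.inducedRiemannianMetric f hpb hfi)) ∧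
      (1 / 2) * ∫ y, (g.scalarCurvature (f y) +
          (g.inducedMetric f hpb hfi).normSq y (g.secondFundamentalForm I' f ν y))
          ∂(riemannianMeasure (g.inducedRiemannianMetric f hpb hfi)) ≤
        ∫ y, (g.inducedMetric f hpb hfi).scalarCurvature y / 2
          ∂(riemannianMeasure (g.inducedRiemannianMetric f hpb hfi)) ∧
      (riemannianMeasure (g.inducedRiemannianMetric f hpb hfi)
          {y | 0 < g.scalarCurvature (f y)} ≠ 0 →
        0 < (1 / 2) * ∫ y, (g.scalarCurvature (f y) +
          (g.inducedMetric f hpb hfi).normSq y (g.secondFundamentalForm I' f ν y))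
          ∂(riemannianMeasure (g.inducedRiemannianMetric f hpb hfi))) := by
  haveI := (g.inducedMetric f hpb hfi).hasLeviCivita
  set gN := g.inducedMetric f hpb hfi with hgN
  set μ := riemannianMeasure (g.inducedRiemannianMetric f hpb hfi) with hμ
  set a : N → ℝ := fun y ↦ gN.normSq y (g.secondFundamentalForm I' f ν y) with ha
  set K : N → ℝ := fun y ↦ gN.scalarCurvature y / 2 with hK
  set R : N → ℝ := fun y ↦ g.scalarCurvature (f y) with hR
  set ρN : N → ℝ := fun y ↦ ρ (f y) with hρN
  have hgN_riem : gN.IsRiemannian := g.isRiemannian_inducedMetric f hpb hfi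
  -- regularity
  have hf : ContMDiff I' I ∞ f := hfi.contMDiff_self
  have hRc : Continuous R := g.contMDiff_scalarCurvature.continuous.comp hf.continuous
  have hac : Continuous a := (g.contMDiff_normSq_secondFundamentalForm hpb hfi ν hν).continuous
  have hKc : Continuous K := gN.contMDiff_scalarCurvature.continuous.div_const 2
  have hρNs : CMDiff ∞ ρN := hρs.comp hf
  have hρNc : Continuous ρN := hρNs.continuous
  have hρN1 : ∀ y, 1 ≤ ρN y := fun y ↦ hρ1 (f y)
  have hR0' : ∀ y, 0 ≤ R y := fun y ↦ hR0 y
  have ha0 : ∀ y, 0 ≤ a y := fun y ↦ gN.normSq_nonneg y hgN_riem _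
  -- the traced Gauss equation with `H = 0`, `ε = 1`
  have hGauss : ∀ y, 2 * K y = R y - 2 * g.ricci (f y) (ν y) (ν y) - a y := by
    intro y
    have h := g.scalarCurvature_inducedMetric_eq hpb hfi hν hun one_ne_zero h2 h3 y
    rw [hmin y] at h
    simp only [hK, hR, ha]
    rw [h]
    ring
  have h215 : ∀ y, g.ricci (f y) (ν y) (ν y) + a y = R y / 2 - K y + a y / 2 := by
    intro y; have := hGauss y; linarith
  have hK12' : ∀ y, |K y + a y / 2| ≤ Λ' * (ρN y)⁻¹ ^ 3 := by
    intro y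
    have h1 : K y + a y / 2 = g.scalarCurvature (f y) / 2 - g.ricci (f y) (ν y) (ν y) := by
      have := hGauss y
      simp only [hR] at this
      linarith
    rw [h1]
    exact hK12 y
  -- measure-theoretic inputs
  have hfinK : ∀ t : ℝ, μ {y | ρN y ≤ t} < ⊤ := fun t ↦
    riemannianVolume_lt_top_of_isCompact_holds (I := I') (n := ∞) (N := N)
      (g.inducedRiemannianMetric f hpb hfi) le_rfl (hproper t)
  have hmeasK : ∀ t : ℝ, MeasurableSet {y | ρN y ≤ t} := fun t ↦
    (isClosed_le hρNc continuous_const).measurableSet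
  have hloc : ∀ {F : N → ℝ}, Continuous F → ∀ t : ℝ, IntegrableOn F {y | ρN y ≤ t} μ :=
    fun hF t ↦ hF.continuousOn.integrableOn_of_subset_isCompact (hproper t) (hmeasK t)
      Subset.rfl (hfinK t).ne
  haveI : IsFiniteMeasureOnCompacts μ := ⟨fun K' hK' ↦
    riemannianVolume_lt_top_of_isCompact_holds (I := I') (n := ∞) (N := N)
      (g.inducedRiemannianMetric f hpb hfi) le_rfl hK'⟩
  -- (2.13) against radial test functions gives the abstract stability hypothesis for (2.15)
  have hstab' : ∀ (η : ℝ → ℝ) (T : ℝ), ContDiff ℝ ∞ η → (∀ t, η t ∈ Icc (0 : ℝ) 1) →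
      (∀ t ≤ 1, η t = 1) → (∀ t, T ≤ t → η t = 0) →
      ∫ y, (R y / 2 - K y + a y / 2) * η (ρN y) ^ 2 ∂μ ≤ C₃ * ∫ y, deriv η (ρN y) ^ 2 ∂μ := by
    intro η T hη _ _ hT
    set u : N → ℝ := fun y ↦ η (ρN y) with hu
    have hus : CMDiff ∞ u := hη.comp_contMDiff hρNs
    have hKT : IsCompact {y | ρN y ≤ T} := hproper T
    have hcu : HasCompactSupport u :=
      HasCompactSupport.intro hKT fun y hy ↦ hT _ (le_of_not_ge hy)
    have h1 := hstab u hus hcu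
    have hL : (fun y ↦ (g.ricci (f y) (ν y) (ν y) + a y) * u y ^ 2) =
        fun y ↦ (R y / 2 - K y + a y / 2) * η (ρN y) ^ 2 := by
      funext y; rw [h215 y]
    rw [hL] at h1
    refine h1.trans ?_
    -- `‖∇u‖² = η'(ρ∘f)² ‖∇(ρ∘f)‖² ≤ C₃ η'(ρ∘f)²`
    have hdη : ∀ t, DifferentiableAt ℝ η t := fun t ↦ (hη.differentiable (by simp)) t
    have hle : ∀ y, gN.gradSq u y ≤ C₃ * deriv η (ρN y) ^ 2 := by
      intro y
      have hgrad : gN.gradSq u y = deriv η (ρN y) ^ 2 * gN.gradSq ρN y :=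
        gN.gradSq_real_comp_eq_deriv_sq_mul (hdη _) ((hρNs y).mdifferentiableAt (by simp))
      have hgradρ : gN.gradSq ρN y ≤ C₃ :=
        (g.gradSq_comp_le_of_isSpacelikeImmersion hg hpb hfi
          ((hρs (f y)).mdifferentiableAt (by simp)) ((hf y).mdifferentiableAt (by simp))).trans
          (hC₃ (f y))
      rw [hgrad, mul_comm]
      exact mul_le_mul_of_nonneg_right hgradρ (sq_nonneg _)
    have hηc : Continuous (fun y ↦ deriv η (ρN y) ^ 2) :=
      ((hη.continuous_deriv (by simp)).comp hρNc).pow 2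
    have hηsupp : HasCompactSupport (fun y ↦ deriv η (ρN y) ^ 2) := by
      refine HasCompactSupport.intro hKT fun y hy ↦ ?_
      have hTy : T < ρN y := lt_of_not_ge hy
      have h0 : η =ᶠ[𝓝 (ρN y)] fun _ ↦ (0 : ℝ) := by
        filter_upwards [Ioi_mem_nhds hTy] with s hs using hT s hs.le
      simp only [h0.deriv_eq, deriv_const, zero_pow two_ne_zero]
    have hint : Integrable (fun y ↦ C₃ * deriv η (ρN y) ^ 2) μ :=
      (hηc.integrable_of_hasCompactSupport hηsupp).const_mul C₃
    calc ∫ y, gN.gradSq u y ∂μ ≤ ∫ y, C₃ * deriv η (ρN y) ^ 2 ∂μ :=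
          integral_mono_of_nonneg (Eventually.of_forall fun y ↦ hgN_riem.gradSq_nonneg u y)
            hint (Eventually.of_forall hle)
      _ = C₃ * ∫ y, deriv η (ρN y) ^ 2 ∂μ := integral_const_mul _ _
  -- the logarithmic cut-off argument
  exact integral_gauss_curvature_pos_of_stability' (μ := μ) (Λ := C₃) hρNc.measurable hρN1 hC
    hG hR0' ha0 (hloc hRc) (hloc hac) hKc.aestronglyMeasurable hK12' hstab'

end SchoenYau

end Literature.Geometry.Lorentzian

end
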